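import Summits.BirchSwinnertonDyer.BirchSwinnertonDyer.Theorems.AlignedTransportAtTwoMainConjectureOfRankZeroBSDAtTwoHalfDescentLayerRing
import Literature.NumberTheory.EllipticCurves.SkinnerUrban2014.CharacteristicIdealBaseChangeProofs
import Mathlib.RingTheory.PowerSeries.NoZeroDivisors
import HarnessLib

/-!
# Route `AlignedTransportAtTwo`, crux C2 `MainConjectureOfRankZeroBSDAtTwo` (stmt-BirchSwinnertonDyer-22298):
# THE BASE TERM CARRIES `p^μ`, I — THE BASE RING: `Λ` modulo `T` is a discrete valuation ring with uniformiser `p̄ = p mod T` and residue field `𝔽_p`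
# (`𝒪₀ = Λ/(T) ≅ ℤ_p`), so `#N = p^{length N}` for every finite `𝒪₀`-module; and `#Λ/(f, T) = p^{ord_p f(0)}` for every `f` with `f(0) ≠ 0`

HONEST FRAMING (cell `bsd-f1-sign2`, WIDTH-5 attached prover seat `bsd-line-att-p5` gen 60 on line `birth` of the lead `bsd-line-att-p2`;
`--supports` stmt-BirchSwinnertonDyer-22298, closes nothing; BSD is NOT proved by any of this; the crux C2, its verdict «blocked-on
`Rank1Residual.GreenbergMuConjectureIrreducible`» and every registered stub (P / T / Kμ / LimDoor / MuIneqʳ / PFμ⁺) are untouched). THEOREMS ONLY —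
pure commutative algebra over `Λ = ℤ_p⟦T⟧`, any prime `p`; no `def`, no instance, no named fact, no `sorry`. Companion at `g = T` of gen 54's
`…HalfDescentLayerRing` (there: `Λ/(g)` for an EISENSTEIN distinguished `g`, `g(0) = p` — the layer polynomials `Ψ_n`; the base polynomial `ω_0 = T` has `T(0) = 0`
and is NOT covered, which is why the lineage's tower formulas `#(X/ω_nX) = #(X/TX)·∏_{m<n} #(X/Ψ_mX)` (g54) and `p^{(pⁿ−1)μ}·#(X/TX) ∣ #(X/ω_nX)` (g56) carry the
base term `#(X/TX) = #Sel_{p^∞}(E/K_∞)^Γ` as an OPAQUE factor). This file supplies the ring-theoretic input for reading that factor (sequel `…HalfDescentBaseIndex`):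

* §1 `𝒪₀ = Λ/(T)` (a domain and a PID: tree `IwasawaAlgebra.quotientSpanXEquiv : 𝒪₀ ≃+* ℤ_p`, `SkinnerUrban2014.isDomain_quotient_span_X`): local, `p̄ = C p mod T` is non-zero and not a unit, ★ **`𝔪_{𝒪₀} = (p̄)`**
  (`maximalIdeal_quotient_X_eq_span`: a non-unit `a mod T` has `a(0) ∈ pℤ_p` and `a ≡ C a(0) (mod T)`), hence ★★ **`𝒪₀` is a DISCRETE VALUATION RING**
  (`isDiscreteValuationRing_quotient_X`), with residue field of order `p` (`natCard_residueField_quotient_X`), and ★ **`#N = p^{length_{𝒪₀} N}`** for every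
  `𝒪₀`-module of finite length (`natCard_eq_pow_length_quotient_X`) — the form in which Fulton's `length = ord(det)` is read as an ORDER in the sequel.
* §2 ★ **`(f, T) = (T, p^{ord_p f(0)})` and `#Λ/(f, T) = p^{ord_p f(0)}`** for every `f ∈ Λ` with `f(0) ≠ 0` (`Λ/(f, T) = ℤ_p/(f(0))`); with the tree's `p`-content split
  `f = p^{μ(f)}·pfree f`: **`ord_p f(0) = μ(f) + ord_p (pfree f)(0) ≥ μ(f)`**, so ★ **`p^{μ(f)} ∣ #Λ/(f, T)`**.
Reading for C2: `#(X/TX)` of the Pontryagin dual `X = X(E/K_∞)` is `#Sel_{p^∞}(E/K_∞)^Γ` (g54) `= #Sel_{p^∞}(E/K)·#ker g_0/#ker h_0` (Greenberg's Lemma 4.3, tree); the sequel shows it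
equals `p^{ord_p f_X(0)}·#(F/TF)` and is therefore divisible by `p^{μ(X)}`. Memo `Cruxes/MainConjectureOfRankZeroBSDAtTwo/BASE-TERM-att-p5-g60.md`.
BSD is not proved by any of this; nothing about any curve is asserted here.

References: L. Washington, GTM 83, §7.1 (Prop. 7.2), §13.2 (Lemma 13.7, Prop. 13.8) [Washington1997]; J.-P. Serre, *Local Fields*, I §6 [SerreLocalFields1979];
R. Greenberg, LNM 1716 (1999), §4 Lemma 4.2–4.3 (p. 103) [GreenbergLNM1716].
-/

set_option linter.dupNamespace false
set_option autoImplicit false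

noncomputable section

open scoped Classical Polynomial

namespace Summit.BirchSwinnertonDyer.BirchSwinnertonDyer.Theorems.AlignedTransportAtTwoHalfDescentBaseRing

open Literature.NumberTheory.EllipticCurves Literature.NumberTheory.EllipticCurves.IwasawaAlgebra
  Summit.BirchSwinnertonDyer.Rank1Residual.X1.MuLambda
  Summit.BirchSwinnertonDyer.Rank1Residual.Iwasawa
  Summit.BirchSwinnertonDyer.BirchSwinnertonDyer.Theorems.DefectPrime
  Summit.BirchSwinnertonDyer.BirchSwinnertonDyer.Theorems.AlignedTransportAtTwoCyclotomicLayerPrime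
  Summit.BirchSwinnertonDyer.BirchSwinnertonDyer.Theorems.AlignedTransportAtTwoHalfDescentLayerRing

universe v

variable {p : ℕ} [hp : Fact p.Prime]

/-! ## §1 `𝒪₀ = Λ/(T)`: a DVR with uniformiser `p̄` and residue field `𝔽_p` -/

section Ring

variable (p) in
/-- `𝒪₀ = Λ/(T)` is non-trivial. [cite: Washington1997, §7.1] -/
theorem nontrivial_quotient_X : Nontrivial (IwasawaAlgebra p ⧸ Ideal.span {(PowerSeries.X : IwasawaAlgebra p)}) :=
  Ideal.Quotient.nontrivial_iff.mpr (by rw [Ne, Ideal.span_singleton_eq_top]; exact (PowerSeries.X_prime (R := ℤ_[p])).not_unit)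

variable (p) in
/-- `𝒪₀ = Λ/(T)` is a local ring (a non-trivial quotient of the local ring `Λ`). [cite: Washington1997, §13.2] -/
theorem isLocalRing_quotient_X : IsLocalRing (IwasawaAlgebra p ⧸ Ideal.span {(PowerSeries.X : IwasawaAlgebra p)}) := by
  haveI := nontrivial_quotient_X p
  exact IsLocalRing.of_surjective' (Ideal.Quotient.mk _) Ideal.Quotient.mk_surjective

variable (p) in
/-- `p̄ = C p mod T` is non-zero in `𝒪₀`. [cite: Washington1997, §7.1] -/
theorem mk_C_natCast_ne_zero :
    Ideal.Quotient.mk (Ideal.span {(PowerSeries.X : IwasawaAlgebra p)}) (PowerSeries.C (p : ℤ_[p])) ≠ 0 := by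
  rw [Ne, Ideal.Quotient.eq_zero_iff_mem, Ideal.mem_span_singleton, PowerSeries.X_dvd_iff, PowerSeries.constantCoeff_C]
  exact Nat.cast_ne_zero.mpr hp.out.ne_zero

variable (p) in
/-- `p̄ = C p mod T` is not a unit of `𝒪₀`: a relation `C p·a − 1 ∈ (T)` gives `p·a(0) = 1` in `ℤ_p`. [cite: Washington1997, §7.1] -/
theorem not_isUnit_mk_C_natCast :
    ¬ IsUnit (Ideal.Quotient.mk (Ideal.span {(PowerSeries.X : IwasawaAlgebra p)}) (PowerSeries.C (p : ℤ_[p]))) := by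
  intro hu
  obtain ⟨v, hv⟩ := IsUnit.exists_right_inv hu
  obtain ⟨a, rfl⟩ := Ideal.Quotient.mk_surjective v
  rw [← map_mul, ← (Ideal.Quotient.mk _).map_one, Ideal.Quotient.eq, Ideal.mem_span_singleton, PowerSeries.X_dvd_iff] at hv
  rw [map_sub, map_mul, PowerSeries.constantCoeff_C, map_one, sub_eq_zero] at hv
  exact PadicInt.irreducible_p.not_isUnit (IsUnit.of_mul_eq_one _ hv)

variable (p) in
/-- ★ **The maximal ideal of `𝒪₀ = Λ/(T)` is `(p̄)`, `p̄ = C p mod T`**: a non-unit `a mod T` has `a(0)` a non-unit of `ℤ_p` (a power series with unit constant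
coefficient is a unit of `Λ`), so `a(0) = p·b`, and `a ≡ C a(0) = C p·C b (mod T)`. [cite: SerreLocalFields1979, I §6] [cite: Washington1997, §7.1] -/
theorem maximalIdeal_quotient_X_eq_span :
    @IsLocalRing.maximalIdeal _ _ (isLocalRing_quotient_X p) =
      Ideal.span {Ideal.Quotient.mk (Ideal.span {(PowerSeries.X : IwasawaAlgebra p)}) (PowerSeries.C (p : ℤ_[p]))} := by
  letI := isLocalRing_quotient_X p
  apply le_antisymm
  · intro s hs
    rw [IsLocalRing.mem_maximalIdeal, mem_nonunits_iff] at hs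
    obtain ⟨a, rfl⟩ := Ideal.Quotient.mk_surjective s
    -- `a = C a(0) + T·a'`
    obtain ⟨a', ha'⟩ : ∃ a' : IwasawaAlgebra p, a = PowerSeries.C (PowerSeries.constantCoeff a) + PowerSeries.X * a' := by
      have hdvd : (PowerSeries.X : IwasawaAlgebra p) ∣ a - PowerSeries.C (PowerSeries.constantCoeff a) := by
        rw [PowerSeries.X_dvd_iff, map_sub, PowerSeries.constantCoeff_C, sub_self]
      obtain ⟨a', h'⟩ := hdvd
      exact ⟨a', by rw [← h']; ring⟩
    -- `a(0)` is not a unit (else `a` is a unit of `Λ`, and so is `a mod T`)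
    have ha0 : ¬ IsUnit (PowerSeries.constantCoeff a) := by
      intro hu
      exact hs ((PowerSeries.isUnit_iff_constantCoeff.mpr hu).map _)
    have ha0' : PowerSeries.constantCoeff a ∈ IsLocalRing.maximalIdeal ℤ_[p] := (IsLocalRing.mem_maximalIdeal _).mpr ha0
    rw [PadicInt.maximalIdeal_eq_span_p, Ideal.mem_span_singleton] at ha0'
    obtain ⟨b, hb⟩ := ha0'
    rw [Ideal.mem_span_singleton]
    refine ⟨Ideal.Quotient.mk _ (PowerSeries.C b), ?_⟩
    rw [← map_mul, Ideal.Quotient.eq, Ideal.mem_span_singleton]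
    refine ⟨a', ?_⟩
    rw [ha', hb, map_mul]
    ring
  · rw [Ideal.span_singleton_le_iff_mem]
    exact (IsLocalRing.mem_maximalIdeal _).mpr (not_isUnit_mk_C_natCast p)

variable (p) in
/-- `𝒪₀ = Λ/(T)` is not a field (`p̄ ≠ 0` lies in the maximal ideal). [cite: Washington1997, §13.2] -/
theorem not_isField_quotient_X : ¬ IsField (IwasawaAlgebra p ⧸ Ideal.span {(PowerSeries.X : IwasawaAlgebra p)}) := by
  letI := isLocalRing_quotient_X p
  rw [IsLocalRing.isField_iff_maximalIdeal_eq, maximalIdeal_quotient_X_eq_span p, Ideal.span_singleton_eq_bot]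
  exact mk_C_natCast_ne_zero p

variable (p) in
/-- ★★ **`𝒪₀ = Λ/(T)` is a discrete valuation ring** (a Noetherian local domain, not a field, with principal maximal ideal `(p̄)`; Mathlib
`IsDiscreteValuationRing.TFAE`). It is `ℤ_p` itself (tree `IwasawaAlgebra.quotientSpanXEquiv`), written as a quotient of `Λ` so that the `Λ`-module quotients `X/TX` are
`𝒪₀`-modules on the nose. [cite: SerreLocalFields1979, I §6] [cite: Washington1997, §7.1] -/
theorem isDiscreteValuationRing_quotient_X :
    @IsDiscreteValuationRing (IwasawaAlgebra p ⧸ Ideal.span {(PowerSeries.X : IwasawaAlgebra p)}) _ (SkinnerUrban2014.isDomain_quotient_span_X p) := by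
  letI := SkinnerUrban2014.isDomain_quotient_span_X p
  letI := isLocalRing_quotient_X p
  have h := IsDiscreteValuationRing.TFAE (IwasawaAlgebra p ⧸ Ideal.span {(PowerSeries.X : IwasawaAlgebra p)}) (not_isField_quotient_X p)
  refine (h.out 0 4).mpr ?_
  rw [maximalIdeal_quotient_X_eq_span p]
  exact ⟨⟨_, rfl⟩⟩

variable (p) in
/-- `#Λ/(T, p^k) = p^k` (`Λ/(T) ≅ ℤ_p` is free of rank `deg T = 1`). [cite: Washington1997, §13.2 (Lemma 13.7, Prop. 13.8)] -/
theorem natCard_quotient_span_X_sup_span_C_pow (k : ℕ) :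
    Nat.card (IwasawaAlgebra p ⧸ (Ideal.span {(PowerSeries.X : IwasawaAlgebra p)} ⊔ Ideal.span {PowerSeries.C ((p : ℤ_[p]) ^ k)})) = p ^ k := by
  have hX := isDistinguishedAt_X p
  haveI := free_quotient_pow p hX 1
  haveI := finite_quotient_pow p hX 1
  have h1 : Ideal.span {(PowerSeries.X : IwasawaAlgebra p)} = Ideal.span {((Polynomial.X : ℤ_[p][X]) : IwasawaAlgebra p) ^ 1} := by
    rw [pow_one, Polynomial.coe_X]
  rw [h1, card_quotient_sup_span_C_pow, finrank_quotient_pow p hX 1, Polynomial.natDegree_X, one_mul, mul_one]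

variable (p) in
/-- `#(𝒪₀/(p̄)) = p`. [cite: Washington1997, Prop. 13.8] -/
theorem natCard_quotient_span_mk_C_natCast :
    Nat.card ((IwasawaAlgebra p ⧸ Ideal.span {(PowerSeries.X : IwasawaAlgebra p)}) ⧸
      Ideal.span {Ideal.Quotient.mk (Ideal.span {(PowerSeries.X : IwasawaAlgebra p)}) (PowerSeries.C (p : ℤ_[p]))}) = p := by
  rw [natCard_quotient_span_mk_eq_natCard_quotient_sup, sup_comm, show (PowerSeries.C (p : ℤ_[p]) : IwasawaAlgebra p) = PowerSeries.C ((p : ℤ_[p]) ^ 1) by rw [pow_one],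
    natCard_quotient_span_X_sup_span_C_pow p 1, pow_one]

variable (p) in
/-- **The residue field of `𝒪₀ = Λ/(T)` has `p` elements** (`κ(𝒪₀) = 𝒪₀/(p̄) = Λ/(T, p) = 𝔽_p`). [cite: SerreLocalFields1979, I §6] -/
theorem natCard_residueField_quotient_X : Nat.card (@IsLocalRing.ResidueField _ _ (isLocalRing_quotient_X p)) = p := by
  letI := isLocalRing_quotient_X p
  change Nat.card ((IwasawaAlgebra p ⧸ Ideal.span {(PowerSeries.X : IwasawaAlgebra p)}) ⧸ IsLocalRing.maximalIdeal _) = p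
  rw [Nat.card_congr (Ideal.quotEquivOfEq (maximalIdeal_quotient_X_eq_span p)).toEquiv]
  exact natCard_quotient_span_mk_C_natCast p

variable (p) in
/-- ★ **`#N = p^{length_{𝒪₀} N}` for every `𝒪₀`-module `N` of finite length**, `𝒪₀ = Λ/(T)` (composition series; every simple `𝒪₀`-module is `κ(𝒪₀) = 𝔽_p`).
[cite: Washington1997, §13.2 (lengths and orders of finite Λ-modules)] -/
theorem natCard_eq_pow_length_quotient_X {N : Type v} [AddCommGroup N] [Module (IwasawaAlgebra p ⧸ Ideal.span {(PowerSeries.X : IwasawaAlgebra p)}) N]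
    (hN : IsFiniteLength (IwasawaAlgebra p ⧸ Ideal.span {(PowerSeries.X : IwasawaAlgebra p)}) N) :
    Nat.card N = p ^ (Module.length (IwasawaAlgebra p ⧸ Ideal.span {(PowerSeries.X : IwasawaAlgebra p)}) N).toNat := by
  letI := isLocalRing_quotient_X p
  rw [Module.natCard_eq_natCard_residueField_pow_length hN, natCard_residueField_quotient_X p]

variable (p) in
/-- `#N = p^{length_{𝒪₀} N}` for every FINITE `𝒪₀`-module `N`. [cite: Washington1997, §13.2 (lengths and orders of finite Λ-modules)] -/
theorem natCard_eq_pow_length_quotient_X_of_finite {N : Type v} [AddCommGroup N] [Module (IwasawaAlgebra p ⧸ Ideal.span {(PowerSeries.X : IwasawaAlgebra p)}) N]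
    [Finite N] : Nat.card N = p ^ (Module.length (IwasawaAlgebra p ⧸ Ideal.span {(PowerSeries.X : IwasawaAlgebra p)}) N).toNat :=
  natCard_eq_pow_length_quotient_X p Module.isFiniteLength_of_finite

end Ring

/-! ## §2 The cyclic index at the base: `(f, T) = (T, p^{ord_p f(0)})`, `#Λ/(f, T) = p^{ord_p f(0)}`, and `p^{μ(f)} ∣ #Λ/(f, T)` -/

section Cyclic

/-- **`(f, T) = (T, p^{ord_p f(0)})` in `Λ`** for `f(0) ≠ 0`: `f ≡ C f(0) (mod T)` and `f(0) = u·p^{ord_p f(0)}` with `u ∈ ℤ_pˣ`. [cite: Washington1997, §7.1] -/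
theorem span_sup_span_X_eq {f : IwasawaAlgebra p} (h0 : PowerSeries.constantCoeff f ≠ 0) :
    Ideal.span {f} ⊔ Ideal.span {(PowerSeries.X : IwasawaAlgebra p)} =
      Ideal.span {(PowerSeries.X : IwasawaAlgebra p)} ⊔ Ideal.span {PowerSeries.C ((p : ℤ_[p]) ^ (PowerSeries.constantCoeff f).valuation)} := by
  set c : ℤ_[p] := PowerSeries.constantCoeff f with hc
  have hcv : c = (PadicInt.unitCoeff h0 : ℤ_[p]) * (p : ℤ_[p]) ^ c.valuation := PadicInt.unitCoeff_spec h0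
  have hXf : (PowerSeries.X : IwasawaAlgebra p) ∣ f - PowerSeries.C c := by
    rw [PowerSeries.X_dvd_iff, map_sub, PowerSeries.constantCoeff_C, hc, sub_self]
  obtain ⟨h, hh⟩ := hXf
  have hu : IsUnit (PowerSeries.C ((PadicInt.unitCoeff h0 : ℤ_[p]) : ℤ_[p]) : IwasawaAlgebra p) := (Units.isUnit _).map PowerSeries.C
  have hCc : (PowerSeries.C c : IwasawaAlgebra p) = PowerSeries.C ((p : ℤ_[p]) ^ c.valuation) * PowerSeries.C ((PadicInt.unitCoeff h0 : ℤ_[p]) : ℤ_[p]) := by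
    rw [← map_mul, mul_comm, ← hcv]
  have hspanC : Ideal.span {(PowerSeries.C c : IwasawaAlgebra p)} = Ideal.span {PowerSeries.C ((p : ℤ_[p]) ^ c.valuation)} := by
    rw [hCc, Ideal.span_singleton_mul_right_unit hu]
  have hf : f = PowerSeries.X * h + PowerSeries.C c := by rw [← hh]; ring
  rw [← hspanC]
  apply le_antisymm
  · refine sup_le ((Ideal.span_singleton_le_iff_mem _).mpr ?_) le_sup_left
    rw [hf]
    exact Submodule.add_mem _ (Ideal.mem_sup_left (Ideal.mem_span_singleton.mpr (dvd_mul_right _ _))) (Ideal.mem_sup_right (Ideal.mem_span_singleton_self _))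
  · refine sup_le le_sup_right ((Ideal.span_singleton_le_iff_mem _).mpr ?_)
    have e : (PowerSeries.C c : IwasawaAlgebra p) = f - PowerSeries.X * h := by rw [hf]; ring
    rw [e]
    exact Submodule.sub_mem _ (Ideal.mem_sup_left (Ideal.mem_span_singleton_self _)) (Ideal.mem_sup_right (Ideal.mem_span_singleton.mpr (dvd_mul_right _ _)))

/-- ★ **THE CYCLIC INDEX AT THE BASE: `#Λ/(f, T) = p^{ord_p f(0)}`** for every `f ∈ Λ` with `f(0) ≠ 0` (`Λ/(f, T) = ℤ_p/(f(0))`). [cite: Washington1997, §7.1 and Prop. 13.8] -/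
theorem natCard_quotient_span_sup_span_X {f : IwasawaAlgebra p} (h0 : PowerSeries.constantCoeff f ≠ 0) :
    Nat.card (IwasawaAlgebra p ⧸ (Ideal.span {f} ⊔ Ideal.span {(PowerSeries.X : IwasawaAlgebra p)})) = p ^ (PowerSeries.constantCoeff f).valuation := by
  rw [span_sup_span_X_eq h0, natCard_quotient_span_X_sup_span_C_pow]

/-- The same index read in `𝒪₀`: `#(𝒪₀/(f̄)) = p^{ord_p f(0)}` for `f(0) ≠ 0`. [cite: Washington1997, §7.1] -/
theorem natCard_quotient_span_mk {f : IwasawaAlgebra p} (h0 : PowerSeries.constantCoeff f ≠ 0) :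
    Nat.card ((IwasawaAlgebra p ⧸ Ideal.span {(PowerSeries.X : IwasawaAlgebra p)}) ⧸
      Ideal.span {Ideal.Quotient.mk (Ideal.span {(PowerSeries.X : IwasawaAlgebra p)}) f}) = p ^ (PowerSeries.constantCoeff f).valuation := by
  rw [natCard_quotient_span_mk_eq_natCard_quotient_sup, natCard_quotient_span_sup_span_X h0]

/-- `Λ/(f, T)` is infinite — `Nat.card = 0` — when `f(0) = 0` (then `(f, T) = (T)` and `Λ/(T) ≅ ℤ_p`). [cite: Washington1997, §7.1] -/
theorem natCard_quotient_span_sup_span_X_eq_zero {f : IwasawaAlgebra p} (h0 : PowerSeries.constantCoeff f = 0) :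
    Nat.card (IwasawaAlgebra p ⧸ (Ideal.span {f} ⊔ Ideal.span {(PowerSeries.X : IwasawaAlgebra p)})) = 0 := by
  have hle : Ideal.span {f} ≤ Ideal.span {(PowerSeries.X : IwasawaAlgebra p)} := by
    rw [Ideal.span_singleton_le_iff_mem, Ideal.mem_span_singleton, PowerSeries.X_dvd_iff, h0]
  rw [sup_eq_right.mpr hle]
  haveI : Infinite (IwasawaAlgebra p ⧸ Ideal.span {(PowerSeries.X : IwasawaAlgebra p)}) :=
    Infinite.of_injective (IwasawaAlgebra.quotientSpanXEquiv p).symm (IwasawaAlgebra.quotientSpanXEquiv p).symm.injective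
  exact Nat.card_eq_zero_of_infinite

/-- **`ord_p f(0) = μ(f) + ord_p (pfree f)(0)`**, hence **`μ(f) ≤ ord_p f(0)`**, for `f(0) ≠ 0` (`f = p^{μ(f)}·pfree f`, tree `eq_C_pow_mu_mul_pfree`).
[cite: Washington1997, §7.1 (Weierstrass preparation)] -/
theorem valuation_constantCoeff_eq_mu_add_and_le {f : IwasawaAlgebra p} (h0 : PowerSeries.constantCoeff f ≠ 0) :
    (PowerSeries.constantCoeff f).valuation = mu f + (PowerSeries.constantCoeff (pfree f)).valuation ∧ mu f ≤ (PowerSeries.constantCoeff f).valuation := by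
  have hc : PowerSeries.constantCoeff f = (p : ℤ_[p]) ^ mu f * PowerSeries.constantCoeff (pfree f) := by
    conv_lhs => rw [eq_C_pow_mu_mul_pfree f]
    rw [map_mul, PowerSeries.constantCoeff_C]
  have hpf : PowerSeries.constantCoeff (pfree f) ≠ 0 := fun h ↦ h0 (by rw [hc, h, mul_zero])
  have heq : (PowerSeries.constantCoeff f).valuation = mu f + (PowerSeries.constantCoeff (pfree f)).valuation := by
    rw [hc]; exact PadicInt.valuation_p_pow_mul _ _ hpf
  exact ⟨heq, heq ▸ Nat.le_add_right _ _⟩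

/-- ★ **`p^{μ(f)} ∣ #Λ/(f, T)`** for every `f ∈ Λ` (`Nat.card`; reads `∣ 0` when `f(0) = 0`). [cite: Washington1997, §7.1 and §13.2] -/
theorem pow_mu_dvd_natCard_quotient_span_sup_span_X (f : IwasawaAlgebra p) :
    p ^ mu f ∣ Nat.card (IwasawaAlgebra p ⧸ (Ideal.span {f} ⊔ Ideal.span {(PowerSeries.X : IwasawaAlgebra p)})) := by
  by_cases h0 : PowerSeries.constantCoeff f = 0
  · rw [natCard_quotient_span_sup_span_X_eq_zero h0]; exact dvd_zero _
  · rw [natCard_quotient_span_sup_span_X h0]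
    exact pow_dvd_pow p (valuation_constantCoeff_eq_mu_add_and_le h0).2

/-- **`λ(f) = 0 ⟺ #Λ/(f, T) = p^{μ(f)}`** for `f(0) ≠ 0`: the base index exceeds `p^{μ(f)}` by EXACTLY `p^{ord_p (pfree f)(0)}`, and `(pfree f)(0)` is a unit iff the
distinguished polynomial of `f` has degree `0` (tree `isUnit_iff_mu_eq_zero_and_lam_eq_zero` applied to `pfree f`). [cite: Washington1997, §7.1 (Weierstrass preparation)] -/
theorem natCard_quotient_span_sup_span_X_eq_pow_mu_iff {f : IwasawaAlgebra p} (h0 : PowerSeries.constantCoeff f ≠ 0) :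
    Nat.card (IwasawaAlgebra p ⧸ (Ideal.span {f} ⊔ Ideal.span {(PowerSeries.X : IwasawaAlgebra p)})) = p ^ mu f ↔ lam f = 0 := by
  have hf0 : f ≠ 0 := fun h ↦ h0 (by rw [h, map_zero])
  obtain ⟨heq, -⟩ := valuation_constantCoeff_eq_mu_add_and_le h0
  have hpf : PowerSeries.constantCoeff (pfree f) ≠ 0 := by
    intro h; apply h0
    conv_lhs => rw [eq_C_pow_mu_mul_pfree f]
    rw [map_mul, h, mul_zero]
  rw [natCard_quotient_span_sup_span_X h0, (Nat.pow_right_injective hp.out.two_le).eq_iff, heq]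
  -- `μ + v = μ ⟺ v = 0 ⟺ (pfree f)(0) unit ⟺ pfree f unit ⟺ μ(pfree f) = 0 ∧ λ(pfree f) = 0`; and `μ(pfree f) = 0`, `λ(pfree f) = λ(f)`
  have hml : mu (pfree f) = 0 ∧ lam (pfree f) = lam f := by
    have h := mu_eq_and_pfree_eq (g := pfree f) (g₀ := pfree f) (a := 0) (red_pfree_ne_zero hf0) (by rw [pow_zero, map_one, one_mul])
    refine ⟨h.1, ?_⟩
    rw [lam, lam, h.2]
  have hunit : (PowerSeries.constantCoeff (pfree f)).valuation = 0 ↔ IsUnit (pfree f) := by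
    rw [PowerSeries.isUnit_iff_constantCoeff]
    constructor
    · intro hv
      have hspec := PadicInt.unitCoeff_spec hpf
      rw [hv, pow_zero, mul_one] at hspec
      rw [hspec]; exact Units.isUnit _
    · intro hu
      by_contra hv
      have h1 : 1 ≤ (PowerSeries.constantCoeff (pfree f)).valuation := Nat.one_le_iff_ne_zero.mpr hv
      have hdvd : (p : ℤ_[p]) ∣ PowerSeries.constantCoeff (pfree f) := by
        rw [← Ideal.mem_span_singleton, ← pow_one (p : ℤ_[p]), PadicInt.mem_span_pow_iff_le_valuation _ hpf]
        exact h1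
      exact PadicInt.irreducible_p.not_isUnit (isUnit_of_dvd_unit hdvd hu)
  constructor
  · intro h
    have hv : (PowerSeries.constantCoeff (pfree f)).valuation = 0 := by omega
    have hu := hunit.mp hv
    rw [isUnit_iff_mu_eq_zero_and_lam_eq_zero] at hu
    rw [← hml.2, hu.2.2]
  · intro hl
    have hu : IsUnit (pfree f) := by
      rw [isUnit_iff_mu_eq_zero_and_lam_eq_zero]
      exact ⟨pfree_ne_zero hf0, hml.1, by rw [hml.2, hl]⟩
    rw [hunit.mpr hu, add_zero]

end Cyclic

end Summit.BirchSwinnertonDyer.BirchSwinnertonDyer.Theorems.AlignedTransportAtTwoHalfDescentBaseRing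

end
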